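import Summits.QuantumFields.QCD.Theorems.SpectralDefectExtinctionExtinctionBuildsQCDStubSignKernelResolventBound
import Summits.QuantumFields.QCD.Theorems.SpectralDefectExtinctionExtinctionBuildsQCDStubArctanKernelLocality
import Summits.QuantumFields.QCD.Theorems.SpectralDefectExtinctionExtinctionBuildsQCDStubHermitianWilsonCombesThomas
import Summits.QuantumFields.QCD.Theorems.SpectralDefectExtinctionExtinctionBuildsQCDStubFermiProjectorScreeningMassPin
import Summits.QuantumFields.QCD.Theorems.SpectralDefectExtinctionExtinctionBuildsQCDStubFermiProjectorScreeningPointwise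
import Summits.QuantumFields.QCD.Theorems.SpectralDefectExtinctionExtinctionBuildsQCDStubFermiProjectorScreeningInMean
import Literature.MathematicalPhysics.QuantumFieldTheory.QCDPhaseQuenchedPositivity

/-!
# Stub 2⁺ `stub_fermiProjectorScreening` of line `weyl-window` (crux `SpectralDefectExtinction.ExtinctionBuildsQCD`,
# item stmt-QuantumFields-8968) — the Aizenman–Graf step: band screening ⇒ Fermi-projector screening (part 4/4, composition)

**Fermi-projector (sign-matrix) screening in phase-quenched mean.**  Under the hypotheses of the line (`N_f ∈ {2,3}`, a
regularisation in the capped clean class `SD⁺(reg; M₀, c)`), BAND SCREENING (`stub_bandScreening`: η-uniform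
phase-quenched Aizenman–Molchanov fractional moments of `(H_W(U, m_f(k)) − iη)⁻¹`, `η ∈ (0,1]`, at the physical rate
`μ a_k` per lattice unit) implies that the colour–spin block of the SIGN MATRIX `sgn(H_W(U, m_f(k))) = cfc Real.sign H_W`
between two sites has phase-quenched mean `≤ C' exp(−μ' a_k ‖x − y‖₁)`, eventually in `k`, on every torus
`2S+1 ≥ 2L_k+1`, for every flavour: the Fermi projector `P₋ = ½(1 − sgn − P₀)` of the Hermitian Wilson–Dirac operator at
the flavour mass is local IN MEAN at a `k`-uniform physical rate — the form in which Stub 5 (`stub_signedLatticeGap`)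
consumes Stub 2 (Aizenman–Graf, J. Phys. A 31 (1998) 6783, §2; Aizenman–Warzel, GSM 168, Ch. 13).

Composition of the landed parts: `π·sgn(H) − 2·arctan(H/Y) = PV∫_{|η|≤Y}(H − iη)⁻¹dη` entrywise with NO invertibility
assumption (`stub_signKernelResolventBound`), the arctan remainder exponentially local for the range-one `H_W` with
spectrum in `[−9, 9]` (`stub_arctanKernelLocality`, `stub_aizenmanGrafPointwise`), Tonelli under `qcdLatticeMeasure`
splitting `(0,1]` (band screening, `‖G‖ ≤ ‖G‖^s η^{s−1}`, `∫₀¹η^{s−1} = 1/s`) from `(1,18]` (Combes–Thomas for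
`H_W − iη`, `stub_hermitianWilsonCombesThomas`) (`stub_aizenmanGrafInMean`), and `|m_f(k)| ≤ 1` eventually
(`stub_massPinAbsLeOne`: TIGHT pins the line from above, `Branch` from below, `a_k/Z_k → 0`).
-/

noncomputable section

namespace Summit.QuantumFields.QCD.Cruxes.ExtinctionBuildsQCD.WeylWindow

open scoped BigOperators ENNReal
open Filter MeasureTheory Matrix Finset
open Literature.MathematicalPhysics.QuantumLattice Literature.MathematicalPhysics.QuantumFieldTheory
  Literature.Probability.LatticeModels
open Summit.QuantumFields.QCD.Theorems.ExtinctionBuildsQCD.Negative (Extinct Tight)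

section Main

/-- **Stub 2⁺ `stub_fermiProjectorScreening`, composed: band screening ⇒ Fermi-projector screening** (line
`weyl-window`, lead seat c2, cycle 2 — the Aizenman–Graf step).  IF `stub_bandScreening` holds (hypothesis `hBS`,
verbatim), then for `N_f ∈ {2,3}` and `reg` in the capped clean class `SD⁺(reg; M₀, c)`, for every mass tuple `m > M₀`
there are `μ' > 0`, `C' > 0` such that eventually in `k`, on every torus `2S+1 ≥ 2L_k+1`, for every flavour `f` and all
sites `x, y`, the phase-quenched mean of the colour–spin block `Σ_{p,q}‖sgn(Γ₅ D_W(U, m_f(k), 1))((x,p),(y,q))‖` of the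
SIGN MATRIX of the Hermitian Wilson–Dirac operator at the flavour mass is `≤ C' exp(−μ' a_k ‖x − y‖₁)`
(`μ' = min μ 1/400`, `C' = 2 max(C,0)/s + 10368`).  Composition of the landed parts `stub_massPinAbsLeOne`,
`stub_aizenmanGrafPointwise`, `stub_aizenmanGrafInMean` with the landed deterministic inputs
`stub_signKernelResolventBound`, `stub_arctanKernelLocality`, `stub_hermitianWilsonCombesThomas`, under the
phase-quenched probability measure `qcdLatticeMeasure` (`qcdPhaseQuenchedExpect_eq_integral_qcdLatticeMeasure`,
`isProbabilityMeasure_qcdLatticeMeasure_all`). -/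
theorem stub_fermiProjectorScreening_of_bandScreening :
    (∀ (Nf : ℕ), Nf = 2 ∨ Nf = 3 → ∀ (reg : QCDRegularisation Nf) (M₀ c : ℝ), 0 ≤ M₀ → 0 < c →
      reg.HasMassScaling → (reg.scheme 0 0 0).HasAsymptoticScaling →
      (∀ m : Fin Nf → ℝ, (∀ f, M₀ < m f) → Extinct Nf reg c m ∧ Tight Nf reg M₀ m) →
      (∃ p : ℕ, ∀ᶠ k in atTop, (reg.L k : ℝ) ≤ (reg.a k)⁻¹ ^ p) → (∀ᶠ k in atTop, -1 < reg.mcrit k) →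
      ∀ m : Fin Nf → ℝ, (∀ f, M₀ < m f) →
        ∃ s μ C : ℝ, 0 < s ∧ s < 1 ∧ 0 < μ ∧ ∀ᶠ k in atTop, ∀ S : ℕ, reg.L k ≤ S →
          ∀ η : ℝ, 0 < η → η ≤ 1 → ∀ (f : Fin Nf) (x y : TorusSite 4 (2 * S + 1)),
            qcdPhaseQuenchedExpect (reg.β k) (2 * S + 1) (fun fl => reg.mcrit k + reg.a k * m fl / reg.Zm k)
                (fun U : GaugeConfig 4 (2 * S + 1) SU3 => ∑ p : Fin 3 × Fin 4, ∑ q : Fin 3 × Fin 4,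
                  ‖((spinorLift gammaFive * wilsonDirac (fundamentalRep (Fin 3)) U
                          (reg.mcrit k + reg.a k * m f / reg.Zm k) 1 - ((η : ℂ) * Complex.I) • 1)⁻¹ :
                      Matrix (TorusSite 4 (2 * S + 1) × Fin 3 × Fin 4) (TorusSite 4 (2 * S + 1) × Fin 3 × Fin 4) ℂ)
                    (x, p) (y, q)‖ ^ s) ≤
              C * Real.exp (-(μ * (reg.a k * (torusTaxiDist x y : ℝ))))) →
    ∀ (Nf : ℕ), Nf = 2 ∨ Nf = 3 → ∀ (reg : QCDRegularisation Nf) (M₀ c : ℝ), 0 ≤ M₀ → 0 < c →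
      reg.HasMassScaling → (reg.scheme 0 0 0).HasAsymptoticScaling →
      (∀ m : Fin Nf → ℝ, (∀ f, M₀ < m f) → Extinct Nf reg c m ∧ Tight Nf reg M₀ m) →
      (∃ p : ℕ, ∀ᶠ k in atTop, (reg.L k : ℝ) ≤ (reg.a k)⁻¹ ^ p) → (∀ᶠ k in atTop, -1 < reg.mcrit k) →
      ∀ m : Fin Nf → ℝ, (∀ f, M₀ < m f) →
        ∃ μ C : ℝ, 0 < μ ∧ 0 < C ∧ ∀ᶠ k in atTop, ∀ S : ℕ, reg.L k ≤ S →
          ∀ (f : Fin Nf) (x y : TorusSite 4 (2 * S + 1)),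
            qcdPhaseQuenchedExpect (reg.β k) (2 * S + 1) (fun fl => reg.mcrit k + reg.a k * m fl / reg.Zm k)
                (fun U : GaugeConfig 4 (2 * S + 1) SU3 => ∑ p : Fin 3 × Fin 4, ∑ q : Fin 3 × Fin 4,
                  ‖(cfc Real.sign (spinorLift gammaFive * wilsonDirac (fundamentalRep (Fin 3)) U
                      (reg.mcrit k + reg.a k * m f / reg.Zm k) 1) :
                    Matrix (TorusSite 4 (2 * S + 1) × Fin 3 × Fin 4) (TorusSite 4 (2 * S + 1) × Fin 3 × Fin 4) ℂ)
                    (x, p) (y, q)‖) ≤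
              C * Real.exp (-(μ * (reg.a k * (torusTaxiDist x y : ℝ))))  := by
  intro hBS Nf hNf reg M₀ c hM₀ hc hMS hAS hbody hcap hbr m hm
  obtain ⟨s, μ, C, hs0, hs1, hμ, hk⟩ := hBS Nf hNf reg M₀ c hM₀ hc hMS hAS hbody hcap hbr m hm
  have hNf16 : Nf ≤ 16 := by rcases hNf with rfl | rfl <;> norm_num
  have hev_m := stub_massPinAbsLeOne Nf hNf16 reg M₀ hM₀ hMS hbr m hm (hbody m hm).2
  have hev_a : ∀ᶠ k in atTop, reg.a k ≤ 1 := reg.tendsto_a.eventually (eventually_le_nhds one_pos)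
  refine ⟨min μ (1 / 400), 2 * max C 0 / s + 10368, lt_min hμ (by norm_num), by positivity, ?_⟩
  filter_upwards [hk, hev_m, hev_a] with k hk hmk hak S hS f x y
  set mq : Fin Nf → ℝ := fun fl => reg.mcrit k + reg.a k * m fl / reg.Zm k with hmq
  have hm₀ : |mq f| ≤ 1 := hmk f
  set d : ℕ := torusTaxiDist x y with hd
  have hprob := isProbabilityMeasure_qcdLatticeMeasure_all (S := 2 * S + 1) (reg.β k) mq
  rw [qcdPhaseQuenchedExpect_eq_integral_qcdLatticeMeasure]
  -- the fractional-moment input in both orientations, in `∫ dν` form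
  have hB : 0 ≤ max C 0 * Real.exp (-(μ * (reg.a k * (d : ℝ)))) := by positivity
  have hFM : ∀ η : ℝ, 0 < η → η ≤ 1 → ∀ x' y' : TorusSite 4 (2 * S + 1),
      (x' = x ∧ y' = y) ∨ (x' = y ∧ y' = x) →
      ∫ U, (∑ p : Fin 3 × Fin 4, ∑ q : Fin 3 × Fin 4,
        ‖((spinorLift gammaFive * wilsonDirac (fundamentalRep (Fin 3)) U (mq f) 1 -
            ((η : ℂ) * Complex.I) • 1)⁻¹ :
            Matrix (TorusSite 4 (2 * S + 1) × Fin 3 × Fin 4) (TorusSite 4 (2 * S + 1) × Fin 3 × Fin 4) ℂ)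
            (x', p) (y', q)‖ ^ s) ∂(qcdLatticeMeasure (2 * S + 1) (reg.β k) mq) ≤
        max C 0 * Real.exp (-(μ * (reg.a k * (d : ℝ)))) := by
    intro η hη0 hη1 x' y' hxy
    have h := hk S hS η hη0 hη1 f x' y'
    rw [qcdPhaseQuenchedExpect_eq_integral_qcdLatticeMeasure] at h
    refine h.trans ?_
    have hdist : torusTaxiDist x' y' = d := by
      rcases hxy with ⟨rfl, rfl⟩ | ⟨rfl, rfl⟩
      · rfl
      · rw [hd, torusTaxiDist_comm]
    rw [hdist]
    exact mul_le_mul_of_nonneg_right (le_max_left _ _) (Real.exp_pos _).le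
  refine (stub_aizenmanGrafInMean stub_signKernelResolventBound stub_hermitianWilsonCombesThomas
    (stub_aizenmanGrafPointwise stub_signKernelResolventBound stub_arctanKernelLocality)
    (2 * S + 1) (qcdLatticeMeasure (2 * S + 1) (reg.β k) mq) (mq f) hm₀ x y s _ hs0 hs1 hB hFM).trans ?_
  -- the two rates under `min μ (1/400)` with `a_k ≤ 1`
  have ha := (reg.a_pos k).le
  have hdnn : (0 : ℝ) ≤ d := Nat.cast_nonneg d
  have hμ' : min μ (1 / 400) ≤ μ := min_le_left _ _
  have hμ'' : min μ (1 / 400) ≤ 1 / 400 := min_le_right _ _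
  have hμ'0 : 0 ≤ min μ (1 / 400) := (lt_min hμ (by norm_num)).le
  have h1 : Real.exp (-(μ * (reg.a k * (d : ℝ)))) ≤ Real.exp (-(min μ (1 / 400) * (reg.a k * (d : ℝ)))) := by
    rw [Real.exp_le_exp]
    nlinarith [mul_nonneg ha hdnn]
  have h2 : Real.exp (-((d : ℝ) / 400)) ≤ Real.exp (-(min μ (1 / 400) * (reg.a k * (d : ℝ)))) := by
    rw [Real.exp_le_exp, neg_le_neg_iff]
    calc min μ (1 / 400) * (reg.a k * (d : ℝ)) ≤ (1 / 400) * (1 * (d : ℝ)) := by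
          refine mul_le_mul hμ'' (mul_le_mul_of_nonneg_right hak hdnn) (mul_nonneg ha hdnn) (by norm_num)
      _ = (d : ℝ) / 400 := by ring
  have hC0 : 0 ≤ max C 0 := le_max_right _ _
  calc 2 * (max C 0 * Real.exp (-(μ * (reg.a k * (d : ℝ))))) / s + 10368 * Real.exp (-((d : ℝ) / 400))
      ≤ 2 * (max C 0 * Real.exp (-(min μ (1 / 400) * (reg.a k * (d : ℝ))))) / s +
          10368 * Real.exp (-(min μ (1 / 400) * (reg.a k * (d : ℝ)))) := by
        gcongr
    _ = (2 * max C 0 / s + 10368) * Real.exp (-(min μ (1 / 400) * (reg.a k * (d : ℝ)))) := by ring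

end Main

end Summit.QuantumFields.QCD.Cruxes.ExtinctionBuildsQCD.WeylWindow

end
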